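import Summits.CriticalPhenomena.Ising3D.TaylorCertificateOddCone
import Summits.CriticalPhenomena.Ising3D.TaylorOddQPoly
import Mathlib.Tactic.Linarith
import Mathlib.Tactic.Positivity
import Mathlib.Tactic.Ring
import HarnessLib

/-!
# The corrected odd HEAD value of a derivative certificate at `(½,½)`: closed form and sign test for head cells
(cell `pub-ising3x`, seat recog-1 gen 10; gate (g2), odd sector with (D5b): what the exact producer /
rational TABLE decides for the head inequality `0 ≤ Σ_{q∈F} oddConeHeadValue q` of `TaylorConeObligations.odd_cell`)

HONEST FRAMING: lottery ticket; floor = tightest certified 3D Ising CFT bounds; no exact-solution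
claim without a proof.

For `α = taylorCrossing ½ ½ S w`, `Ψ = Σ_{(a,b)∈Sψ} ψ(a,b) · taylorCoeffAt ½ ½ (a,b)`, an odd-sector `(Δ, ℓ)`
and a term `(n,j)` with `j ≤ Δ + n` (`t = Δσ - Δε`, `s̄ = (Δσ+Δε)/2`, `E = Δ + n`):
`oddConeHeadValue = (½)^{2Δσ} (½)^Δ (½)^n · B(n,j)` with the BRACKET
`B = (-1)^ℓ cₛ (½)^{Δε-Δσ} q̂₃ + c₊ (q̂₄ - q̂₅) + ½κ₀⁻¹ (c₋ (½)^{-2Δσ} ψ̂₀ - c₊ (½)^{-2Δε} ψ̂_t)`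
(`oddConeHeadValue_half_eq`; `cₛ = A_{n,j}(-t/2,t/2)/λ_ℓ`, `c₊ = A_{n,j}(t/2,t/2)/λ_ℓ`, `c₋ = A_{n,j}(-t/2,-t/2)/λ_ℓ`,
`q̂₃ = qSum (w 2) S s̄ (-1) E j`, `q̂₄ = qSum (w 3) S Δσ (-1) E j`, `q̂₅ = qSum (w 4) S Δσ 1 E j`,
`ψ̂₀ = qSum ψ Sψ 0 0 E j`, `ψ̂_t = qSum ψ Sψ t 0 E j`). Hence for a head set `F` in the range `j ≤ Δ + n`:
`0 ≤ Σ_{q∈F} oddConeHeadValue q ↔ 0 ≤ Σ_{q∈F} (½)^n B(n,j)` (`sum_oddConeHeadValue_half_nonneg_iff`) — one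
interval inequality per (Δ-cell, ℓ), rational in the weights and in the Dolan–Osborn coefficients, times the
factors `(½)^{Δε-Δσ}`, `(½)^{-2Δσ}`, `(½)^{-2Δε}` (enclosed over the box). Sources: Kos–Poland–Simmons-Duffin
2014 §3.3 eq. (3.16); Dolan–Osborn 2004 §3 eq. (3.11).
-/

namespace Summit.CriticalPhenomena.Ising3D

open Finset Set
open Literature.MathematicalPhysics.QuantumFieldTheory.ConformalBootstrap3D

/-- The bracket `B(n,j)` of the corrected odd head value at `(½,½)` (module docstring). [folklore] -/
noncomputable def oddConeHeadBracket (S : Finset (ℕ × ℕ)) (w : Fin 5 → ℕ × ℕ → ℝ)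
    (Sψ : Finset (ℕ × ℕ)) (ψ : ℕ × ℕ → ℝ) (κ₀ Δσ Δε Δ : ℝ) (ℓ : ℕ) (q : ℕ × ℕ) : ℝ :=
  (-1 : ℝ) ^ ℓ * (hrCoeffAB (-(Δσ - Δε) / 2) ((Δσ - Δε) / 2) Δ ℓ q.1 q.2 / legendreLam ℓ) *
        ((1 / 2 : ℝ) ^ (Δε - Δσ) * qSum (w 2) S ((Δσ + Δε) / 2) (-1) (Δ + (q.1 : ℝ)) q.2) +
      hrCoeffAB ((Δσ - Δε) / 2) ((Δσ - Δε) / 2) Δ ℓ q.1 q.2 / legendreLam ℓ *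
        (qSum (w 3) S Δσ (-1) (Δ + (q.1 : ℝ)) q.2 - qSum (w 4) S Δσ 1 (Δ + (q.1 : ℝ)) q.2) +
    κ₀⁻¹ / 2 *
      (hrCoeffAB (-(Δσ - Δε) / 2) (-(Δσ - Δε) / 2) Δ ℓ q.1 q.2 / legendreLam ℓ *
          ((1 / 2 : ℝ) ^ (-(2 * Δσ)) * qSum ψ Sψ 0 0 (Δ + (q.1 : ℝ)) q.2) -
        hrCoeffAB ((Δσ - Δε) / 2) ((Δσ - Δε) / 2) Δ ℓ q.1 q.2 / legendreLam ℓ *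
          ((1 / 2 : ℝ) ^ (-(2 * Δε)) * qSum ψ Sψ (Δσ - Δε) 0 (Δ + (q.1 : ℝ)) q.2))

/-- **The corrected odd head value at `(½,½)`, factorised**: for `j ≤ Δ + n`,
`oddConeHeadValue = (½)^{2Δσ} (½)^Δ (½)^n · B(n,j)`. [cite: KosPolandSimmonsduffin2014, §3.2 eq. (3.13)] -/
theorem oddConeHeadValue_half_eq (S : Finset (ℕ × ℕ)) (w : Fin 5 → ℕ × ℕ → ℝ)
    (Sψ : Finset (ℕ × ℕ)) (ψ : ℕ × ℕ → ℝ) (κ₀ Δσ Δε Δ : ℝ) (ℓ : ℕ) (q : ℕ × ℕ)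
    (hj : (q.2 : ℝ) ≤ Δ + (q.1 : ℝ)) :
    oddConeHeadValue (taylorCrossing (1 / 2) (1 / 2) S w)
        (∑ ab ∈ Sψ, ψ ab • taylorCoeffAt (1 / 2) (1 / 2) ab) κ₀ Δσ Δε Δ ℓ q =
      (1 / 2 : ℝ) ^ (2 * Δσ) * (1 / 2 : ℝ) ^ Δ * (1 / 2 : ℝ) ^ (q.1 : ℝ) *
        oddConeHeadBracket S w Sψ ψ κ₀ Δσ Δε Δ ℓ q := by
  have h0 : (0 : ℝ) < 1 / 2 := by norm_num
  have eψ0 : (∑ ab ∈ Sψ, ψ ab • taylorCoeffAt (1 / 2) (1 / 2) ab) (zMono (Δ + (q.1 : ℝ)) q.2) =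
      (1 / 2 : ℝ) ^ (Δ + (q.1 : ℝ)) * qSum ψ Sψ 0 0 (Δ + (q.1 : ℝ)) q.2 := by
    have h := sum_smul_taylorCoeffAt_crossF_zMono_half ψ Sψ 0 0 (Δ + (q.1 : ℝ)) q.2 hj
    rw [crossF_zero_zero] at h
    rw [h, mul_zero, Real.rpow_zero, one_mul]
  have eψt : (∑ ab ∈ Sψ, ψ ab • taylorCoeffAt (1 / 2) (1 / 2) ab)
        (crossF (Δσ - Δε) 0 (zMono (Δ + (q.1 : ℝ)) q.2)) =
      (1 / 2 : ℝ) ^ (2 * (Δσ - Δε)) * (1 / 2 : ℝ) ^ (Δ + (q.1 : ℝ)) *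
        qSum ψ Sψ (Δσ - Δε) 0 (Δ + (q.1 : ℝ)) q.2 :=
    sum_smul_taylorCoeffAt_crossF_zMono_half _ _ _ _ _ _ hj
  -- prefactor bookkeeping
  have hE : (1 / 2 : ℝ) ^ (Δ + (q.1 : ℝ)) = (1 / 2 : ℝ) ^ Δ * (1 / 2 : ℝ) ^ (q.1 : ℝ) :=
    Real.rpow_add h0 _ _
  have hσ : (1 / 2 : ℝ) ^ (2 * Δσ) * (1 / 2 : ℝ) ^ (-(2 * Δσ)) = 1 := by
    rw [← Real.rpow_add h0, add_neg_cancel, Real.rpow_zero]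
  have hε : (1 / 2 : ℝ) ^ (2 * (Δσ - Δε)) = (1 / 2 : ℝ) ^ (2 * Δσ) * (1 / 2 : ℝ) ^ (-(2 * Δε)) := by
    rw [← Real.rpow_add h0]; congr 1; ring
  unfold oddConeHeadValue
  rw [oddTermValue_half_eq S w Δσ Δε Δ ℓ q hj, eψ0, eψt, hE, hε, oddConeHeadBracket]
  -- `ψ̂₀` term: insert `1 = (½)^{2Δσ} (½)^{-2Δσ}`
  have e0 : (1 / 2 : ℝ) ^ Δ * (1 / 2 : ℝ) ^ (q.1 : ℝ) * qSum ψ Sψ 0 0 (Δ + (q.1 : ℝ)) q.2 =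
      (1 / 2 : ℝ) ^ (2 * Δσ) * (1 / 2 : ℝ) ^ Δ * (1 / 2 : ℝ) ^ (q.1 : ℝ) *
        ((1 / 2 : ℝ) ^ (-(2 * Δσ)) * qSum ψ Sψ 0 0 (Δ + (q.1 : ℝ)) q.2) := by
    calc (1 / 2 : ℝ) ^ Δ * (1 / 2 : ℝ) ^ (q.1 : ℝ) * qSum ψ Sψ 0 0 (Δ + (q.1 : ℝ)) q.2
        = ((1 / 2 : ℝ) ^ (2 * Δσ) * (1 / 2 : ℝ) ^ (-(2 * Δσ))) *
            ((1 / 2 : ℝ) ^ Δ * (1 / 2 : ℝ) ^ (q.1 : ℝ) * qSum ψ Sψ 0 0 (Δ + (q.1 : ℝ)) q.2) := by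
          rw [hσ, one_mul]
      _ = _ := by ring
  rw [e0]
  ring

/-- **Sign test for an odd head cell**: for a head set `F` with `j ≤ Δ + n` on `F`,
`0 ≤ Σ_{q∈F} oddConeHeadValue q ↔ 0 ≤ Σ_{q∈F} (½)^n · B(n,j)`. [cite: KosPolandSimmonsduffin2014, §3.3 eq. (3.16)] -/
theorem sum_oddConeHeadValue_half_nonneg_iff (S : Finset (ℕ × ℕ)) (w : Fin 5 → ℕ × ℕ → ℝ)
    (Sψ : Finset (ℕ × ℕ)) (ψ : ℕ × ℕ → ℝ) (κ₀ Δσ Δε Δ : ℝ) (ℓ : ℕ) (F : Finset (ℕ × ℕ))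
    (hF : ∀ q ∈ F, (q.2 : ℝ) ≤ Δ + (q.1 : ℝ)) :
    0 ≤ ∑ q ∈ F, oddConeHeadValue (taylorCrossing (1 / 2) (1 / 2) S w)
        (∑ ab ∈ Sψ, ψ ab • taylorCoeffAt (1 / 2) (1 / 2) ab) κ₀ Δσ Δε Δ ℓ q ↔
      0 ≤ ∑ q ∈ F, (1 / 2 : ℝ) ^ (q.1 : ℝ) * oddConeHeadBracket S w Sψ ψ κ₀ Δσ Δε Δ ℓ q := by
  have h0 : (0 : ℝ) < 1 / 2 := by norm_num
  have hP : 0 < (1 / 2 : ℝ) ^ (2 * Δσ) * (1 / 2 : ℝ) ^ Δ :=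
    mul_pos (Real.rpow_pos_of_pos h0 _) (Real.rpow_pos_of_pos h0 _)
  have hsum : ∑ q ∈ F, oddConeHeadValue (taylorCrossing (1 / 2) (1 / 2) S w)
        (∑ ab ∈ Sψ, ψ ab • taylorCoeffAt (1 / 2) (1 / 2) ab) κ₀ Δσ Δε Δ ℓ q =
      ((1 / 2 : ℝ) ^ (2 * Δσ) * (1 / 2 : ℝ) ^ Δ) *
        ∑ q ∈ F, (1 / 2 : ℝ) ^ (q.1 : ℝ) * oddConeHeadBracket S w Sψ ψ κ₀ Δσ Δε Δ ℓ q := by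
    rw [Finset.mul_sum]
    refine Finset.sum_congr rfl fun q hq => ?_
    rw [oddConeHeadValue_half_eq S w Sψ ψ κ₀ Δσ Δε Δ ℓ q (hF q hq)]
    ring
  rw [hsum]
  exact mul_nonneg_iff_of_pos_left hP

/-- The CANONICAL head set of a cell lies in the range `j ≤ Δ + n` whenever it is contained in the
descendant range and `ℓ ≤ Δ` (e.g. `Δ` above the unitarity bound). [folklore] -/
theorem headSet_cast_le (Δ : ℝ) (ℓ : ℕ) (hℓΔ : (ℓ : ℝ) ≤ Δ) (F : Finset (ℕ × ℕ))
    (hF : ∀ q ∈ F, InDescendantRange ℓ q.1 q.2) : ∀ q ∈ F, (q.2 : ℝ) ≤ Δ + (q.1 : ℝ) :=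
  fun q hq => cast_le_add_of_inDescendantRange hℓΔ (hF q hq)

end Summit.CriticalPhenomena.Ising3D
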